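import Summits.QuantumFields.BalabanUV.Beta.SubsolutionMeanValueBox

/-!
# Beta / HarmonicGradientInterior — THE INTERIOR DIFFERENCE ESTIMATE FOR LATTICE-HARMONIC FUNCTIONS ON A TORUS BOX, IN THE KERNEL:
# `|u(x₀ + e_μ) − u(x₀)| ≤ K_d·max_{dist ≤ 2R+2}|u|∕(R+1)` — the discrete Cauchy estimate for the FLAT constant-weight Laplacian
# (first module of the chain «LATTICE-GRADIENT-MEMBER»: the GRADIENT member (3.42)₂'s SHAPE of [B9] Thm 3.1 at MODEL level, O.2 item (i))

WHAT IS CERTIFIED (kernel, 0 sorry).  On the unit torus `UT N` with bonds `bsrc∕btgt` and a CONSTANT bond weight `c ≡ c₀ ≠ 0` (`W(x)`,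
`(Nu)(x)` written out as in files 12∕14∕`SubsolutionMeanValue`; HARMONIC at `x` means `W(x)·u(x) = (Nu)(x)`):
* §1 torus shifts commute: `up_up_comm`, `dn_up_comm` (`x + e_μ + e_ν = x + e_ν + e_μ`, `(x + e_μ) − e_ν = (x − e_ν) + e_μ`);
* §2 **`harmonic_shift_sub`** — TRANSLATION INVARIANCE: if `u` is harmonic at `x` and at `x + e_μ` then `v = u(· + e_μ) − u` is harmonic
  at `x`; **`abs_subsolution_of_harmonic`** — `|v|` is a sub-solution wherever `v` is harmonic;
* §3 **`harmonic_energy_ball_le`** — CACCIOPPOLI FOR HARMONIC FUNCTIONS: `u` harmonic on `dist(·,x₀) ≤ 2ρ` (`ρ ≥ 1`) ⟹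
  `Σ_{b : both ends in dist ≤ ρ} (u(b₊) − u(b₋))² ≤ (52d∕ρ²)·Σ_{dist ≤ 2ρ} u²` (DG2 `caccioppoli_cutoff` on `u₊` and `u₋` with the cutoff
  `DeGiorgiStep.cut x₀ (2ρ) ρ`); **`sum_fdiff_sq_ball_le`** — `Σ_{dist ≤ R} (u(x + e_μ) − u(x))² ≤ (52d∕(R+1)²)·Σ_{dist ≤ 2R+2} u²`;
* §4 **`harmonic_fdiff_le`** — THE INTERIOR DIFFERENCE ESTIMATE: `R ≥ 1`, `10R + 4 ≤ N_i`, `u` harmonic on `dist(·,x₀) ≤ 2R+2`,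
  `|u| ≤ M` there ⟹ **`|u(x₀ + e_μ) − u(x₀)| ≤ K_d·M∕(R+1)`**, `K_d = C_d·√(52d)·3^d` (`Kgrad`; `C_d` = DG4's `Cmv`; depends on `d` ONLY):
  DG4 `meanValue_ball` applied to the nonnegative sub-solution `|v|` on the ball of radius `R`, §3 for its ℓ² mass, DG3a `card_ball_le`.
(unit `b2b-balaban-beta-d4-p2`, GEN 11, MODEL crew; claim «LATTICE-GRADIENT-MEMBER» journal l.23681; consumers: `GreenGradientRowSum`,
`GradientMemberBox`.)  HONEST FRAMING: discharging `BetaPertH` makes Bałaban's UV stability UNCONDITIONAL — NOT the continuum limit, NOT the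
Clay problem.  HONEST DEPENDENCY (verbatim): «continuum YM on T⁴ ⇐ BetaPertH ∧ nine spine estimates (0/9 proved); BetaPertH ⇐ (D1) ∧ (D4) ∧
CAP+tail; G-an2-4 gates asym, D1 and NE2/3/4.»  THIS MODULE DISCHARGES NOTHING of `BetaPertH`, asserts NOTHING printed and cites nothing as a
fact (ABSOLUTE RULE): [folklore] finite lattice calculus about the FREE torus Laplacian; CONSTANT weights and FLAT transport (`U = 1`) ONLY — the
translation `x ↦ x + e_μ` commutes with the Laplacian, which fails for a covariant Laplacian with arbitrary bond matrices (no gradient member at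
MODEL level there; print's device is [B4] Lemma 2.2's (p,q)-chain in the small background field — NOT reproduced).  LOCATORS (shape only):
[Balaban1985BackgroundPropagators] Thm 3.1 (3.42) p. 397; [Balaban1983RegularityDecay] Lemma 2.2 (2.17) pp. 577–578.  No class change on row D4
(critical-path width 0; D4 DISCHARGE NO DATE); NOT BetaPertH, NOT continuum, NOT Clay, NOT summit progress.
-/

open scoped BigOperators
open Finset

namespace Summit.QuantumFields.BalabanUV.Beta.HarmonicGradientInterior

open Literature.MathematicalPhysics.QuantumFieldTheory.Balaban1983to89
open Literature.MathematicalPhysics.QuantumFieldTheory.Balaban1983to89.B9Thm37GluePU (bsrc btgt bsrc_apply btgt_apply)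
open B5TorusCover (UT)
open B5Leibniz121 (up dn up_dn dist_up_le)
open Summit.QuantumFields.BalabanUV.Beta.SubsolutionMeanValue (nb_mono posPart_subsolution)
open Summit.QuantumFields.BalabanUV.Beta.SubsolutionCaccioppoli (caccioppoli_cutoff)
open Summit.QuantumFields.BalabanUV.Beta.TorusBoxSupersolution (wsum_src_const wsum_tgt_const)
open Summit.QuantumFields.BalabanUV.Beta.DeGiorgiStep (card_ball_le W_const cut cut_eq_one abs_cut_bond_le cut_jump_mem
  dist_lt_of_cut_ne_zero)
open Summit.QuantumFields.BalabanUV.Beta.SubsolutionMeanValueBox (Cmv Cmv_pos meanValue_ball)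

noncomputable section

variable {d : ℕ} {N : Fin d → ℕ} [∀ i, NeZero (N i)]

/-! ## §1 Torus shifts commute -/

/-- `x + e_μ + e_ν = x + e_ν + e_μ`. [folklore] -/
theorem up_up_comm (x : UT N) (μ ν : Fin d) : up (up x μ) ν = up (up x ν) μ := by
  rcases eq_or_ne μ ν with h | h
  · rw [h]
  · unfold up
    show UT.ofSite N _ = UT.ofSite N _
    congr 1
    simp only [UT.toSite, UT.ofSite]
    rw [Function.update_of_ne (Ne.symm h), Function.update_of_ne h, Function.update_comm h]

/-- `(x + e_μ) − e_ν = (x − e_ν) + e_μ`. [folklore] -/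
theorem dn_up_comm (x : UT N) (μ ν : Fin d) : dn (up x μ) ν = up (dn x ν) μ := by
  have h : up (up (dn x ν) μ) ν = up x μ := by rw [up_up_comm, up_dn]
  have h2 := congrArg (fun y => dn y ν) h
  rw [← h2, B5DirichletDg.dn_up]

/-- `dist(x + e_μ, x₀) ≤ dist(x, x₀) + 1`. [folklore] -/
theorem dist_up_le_add_one (x x₀ : UT N) (μ : Fin d) : dist (up x μ) x₀ ≤ dist x x₀ + 1 := by
  have h1 := dist_triangle (up x μ) x x₀
  have h2 := dist_up_le x μ
  rw [dist_comm x (up x μ)] at h2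
  linarith

/-! ## §2 Translation invariance: the forward difference of a harmonic function is harmonic; `|harmonic|` is a sub-solution -/

/-- The neighbour sum for a constant weight: `(Nw)(x) = c₀²·Σ_ν w(x − e_ν) + c₀²·Σ_ν w(x + e_ν)`. [folklore] -/
theorem nb_const {c : UT N × Fin d → ℝ} {c₀ : ℝ} (hc : ∀ b, c b = c₀) (w : UT N → ℝ) (x : UT N) :
    ((∑ b ∈ univ.filter (fun b : UT N × Fin d => btgt b = x), c b ^ 2 * w (bsrc b)) +
        ∑ b ∈ univ.filter (fun b : UT N × Fin d => bsrc b = x), c b ^ 2 * w (btgt b)) =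
      c₀ ^ 2 * ∑ ν, w (dn x ν) + c₀ ^ 2 * ∑ ν, w (up x ν) := by
  rw [wsum_tgt_const hc, wsum_src_const hc]

/-- **TRANSLATION INVARIANCE.**  For a constant weight, if `u` is harmonic at `x` and at `x + e_μ`, then `v = u(· + e_μ) − u` is harmonic
at `x`. [folklore] -/
theorem harmonic_shift_sub [NeZero d] {c : UT N × Fin d → ℝ} {c₀ : ℝ} (hc : ∀ b, c b = c₀) (u : UT N → ℝ) (μ : Fin d) (x : UT N)
    (hx : ((∑ b ∈ univ.filter (fun b : UT N × Fin d => btgt b = x), c b ^ 2) +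
          ∑ b ∈ univ.filter (fun b : UT N × Fin d => bsrc b = x), c b ^ 2) * u x =
        ((∑ b ∈ univ.filter (fun b : UT N × Fin d => btgt b = x), c b ^ 2 * u (bsrc b)) +
          ∑ b ∈ univ.filter (fun b : UT N × Fin d => bsrc b = x), c b ^ 2 * u (btgt b)))
    (hx' : ((∑ b ∈ univ.filter (fun b : UT N × Fin d => btgt b = up x μ), c b ^ 2) +
          ∑ b ∈ univ.filter (fun b : UT N × Fin d => bsrc b = up x μ), c b ^ 2) * u (up x μ) =
        ((∑ b ∈ univ.filter (fun b : UT N × Fin d => btgt b = up x μ), c b ^ 2 * u (bsrc b)) +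
          ∑ b ∈ univ.filter (fun b : UT N × Fin d => bsrc b = up x μ), c b ^ 2 * u (btgt b))) :
    ((∑ b ∈ univ.filter (fun b : UT N × Fin d => btgt b = x), c b ^ 2) +
          ∑ b ∈ univ.filter (fun b : UT N × Fin d => bsrc b = x), c b ^ 2) * (u (up x μ) - u x) =
        ((∑ b ∈ univ.filter (fun b : UT N × Fin d => btgt b = x), c b ^ 2 * (u (up (bsrc b) μ) - u (bsrc b))) +
          ∑ b ∈ univ.filter (fun b : UT N × Fin d => bsrc b = x), c b ^ 2 * (u (up (btgt b) μ) - u (btgt b))) := by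
  rw [nb_const hc (fun y => u (up y μ) - u y) x, W_const hc x]
  rw [nb_const hc u x, W_const hc x] at hx
  rw [nb_const hc u (up x μ), W_const hc (up x μ)] at hx'
  simp only [Finset.sum_sub_distrib, mul_sub]
  have h1 : ∑ ν, u (up (dn x ν) μ) = ∑ ν, u (dn (up x μ) ν) :=
    Finset.sum_congr rfl fun ν _ => by rw [dn_up_comm]
  have h2 : ∑ ν, u (up (up x ν) μ) = ∑ ν, u (up (up x μ) ν) :=
    Finset.sum_congr rfl fun ν _ => by rw [up_up_comm]
  rw [h1, h2]
  linarith

/-- **`|v|` IS A SUB-SOLUTION WHEREVER `v` IS HARMONIC** (triangle inequality on the neighbour sum; any weights). [folklore] -/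
theorem abs_subsolution_of_harmonic {c : UT N × Fin d → ℝ} (v : UT N → ℝ) (x : UT N)
    (hx : ((∑ b ∈ univ.filter (fun b : UT N × Fin d => btgt b = x), c b ^ 2) +
          ∑ b ∈ univ.filter (fun b : UT N × Fin d => bsrc b = x), c b ^ 2) * v x =
        ((∑ b ∈ univ.filter (fun b : UT N × Fin d => btgt b = x), c b ^ 2 * v (bsrc b)) +
          ∑ b ∈ univ.filter (fun b : UT N × Fin d => bsrc b = x), c b ^ 2 * v (btgt b))) :
    ((∑ b ∈ univ.filter (fun b : UT N × Fin d => btgt b = x), c b ^ 2) +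
          ∑ b ∈ univ.filter (fun b : UT N × Fin d => bsrc b = x), c b ^ 2) * |v x| ≤
        ((∑ b ∈ univ.filter (fun b : UT N × Fin d => btgt b = x), c b ^ 2 * |v (bsrc b)|) +
          ∑ b ∈ univ.filter (fun b : UT N × Fin d => bsrc b = x), c b ^ 2 * |v (btgt b)|) := by
  have hW : 0 ≤ ((∑ b ∈ univ.filter (fun b : UT N × Fin d => btgt b = x), c b ^ 2) +
      ∑ b ∈ univ.filter (fun b : UT N × Fin d => bsrc b = x), c b ^ 2) :=
    add_nonneg (Finset.sum_nonneg fun _ _ => sq_nonneg _) (Finset.sum_nonneg fun _ _ => sq_nonneg _)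
  rw [← abs_of_nonneg hW, ← abs_mul, hx]
  refine (abs_add_le _ _).trans (add_le_add ?_ ?_)
  · refine (abs_sum_le_sum_abs _ _).trans (le_of_eq (Finset.sum_congr rfl fun b _ => ?_))
    rw [abs_mul, abs_of_nonneg (sq_nonneg _)]
  · refine (abs_sum_le_sum_abs _ _).trans (le_of_eq (Finset.sum_congr rfl fun b _ => ?_))
    rw [abs_mul, abs_of_nonneg (sq_nonneg _)]

/-! ## §3 Caccioppoli for harmonic functions on a ball -/

/-- **ENERGY OF A NONNEGATIVE SUB-SOLUTION ON THE INNER BALL** (DG2 `caccioppoli_cutoff` with the cutoff `cut x₀ (2ρ) ρ`, which is `1` on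
`dist ≤ ρ`, `0` off `dist < 2ρ`, `1/ρ`-Lipschitz along bonds, jumps inside `dist ≤ 2ρ`): for a constant weight `c ≡ c₀`, `ρ ≥ 1` and `v ≥ 0` a
sub-solution on `dist(·,x₀) ≤ 2ρ`, `Σ_{b : both ends in dist ≤ ρ} (v(b₊) − v(b₋))² ≤ (26d∕ρ²)·Σ_{dist ≤ 2ρ} v²`. [folklore] -/
theorem subsolution_energy_ball_le [NeZero d] {c : UT N × Fin d → ℝ} {c₀ : ℝ} (hc : ∀ b, c b = c₀) (hc₀ : c₀ ≠ 0) (x₀ : UT N)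
    {ρ : ℕ} (hρ : 1 ≤ ρ) (v : UT N → ℝ) (hv0 : ∀ y, 0 ≤ v y)
    (hv : ∀ x ∈ univ.filter (fun x : UT N => dist x x₀ ≤ 2 * ρ),
      ((∑ b ∈ univ.filter (fun b : UT N × Fin d => btgt b = x), c b ^ 2) +
          ∑ b ∈ univ.filter (fun b : UT N × Fin d => bsrc b = x), c b ^ 2) * v x ≤
        ((∑ b ∈ univ.filter (fun b : UT N × Fin d => btgt b = x), c b ^ 2 * v (bsrc b)) +
          ∑ b ∈ univ.filter (fun b : UT N × Fin d => bsrc b = x), c b ^ 2 * v (btgt b))) :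
    ∑ b ∈ univ.filter (fun b : UT N × Fin d => dist (bsrc b) x₀ ≤ ρ ∧ dist (btgt b) x₀ ≤ ρ), (v (btgt b) - v (bsrc b)) ^ 2 ≤
      26 * d / (ρ : ℝ) ^ 2 * ∑ x ∈ univ.filter (fun x : UT N => dist x x₀ ≤ 2 * ρ), v x ^ 2 := by
  classical
  set η : UT N → ℝ := cut x₀ (2 * ρ) ρ with hη
  have hρ0 : 0 < ρ := hρ
  have hρR : (0 : ℝ) < ρ := by exact_mod_cast hρ0
  have hc2 : (0 : ℝ) < c₀ ^ 2 := by positivity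
  -- `v` is a sub-solution wherever `η ≠ 0`
  have hsubη : ∀ x, η x ≠ 0 →
      ((∑ b ∈ univ.filter (fun b : UT N × Fin d => btgt b = x), c b ^ 2) +
          ∑ b ∈ univ.filter (fun b : UT N × Fin d => bsrc b = x), c b ^ 2) * v x ≤
        ((∑ b ∈ univ.filter (fun b : UT N × Fin d => btgt b = x), c b ^ 2 * v (bsrc b)) +
          ∑ b ∈ univ.filter (fun b : UT N × Fin d => bsrc b = x), c b ^ 2 * v (btgt b)) := by
    intro x hx
    refine hv x (Finset.mem_filter.mpr ⟨Finset.mem_univ _, ?_⟩)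
    have h := (dist_lt_of_cut_ne_zero x₀ hx).le
    exact_mod_cast h
  have hC := caccioppoli_cutoff bsrc btgt c η v hv0 hsubη hρR (fun b => abs_cut_bond_le x₀ (2 * ρ) hρ0 b)
    (univ.filter (fun x : UT N => dist x x₀ ≤ ((2 * ρ : ℕ) : ℝ))) (fun b hb => cut_jump_mem x₀ (2 * ρ) ρ b hb)
  -- the right side: constant site weight
  have hR' : ∑ x ∈ univ.filter (fun x : UT N => dist x x₀ ≤ ((2 * ρ : ℕ) : ℝ)),
      ((∑ b ∈ univ.filter (fun b : UT N × Fin d => btgt b = x), c b ^ 2) +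
          ∑ b ∈ univ.filter (fun b : UT N × Fin d => bsrc b = x), c b ^ 2) * v x ^ 2 =
        2 * d * c₀ ^ 2 * ∑ x ∈ univ.filter (fun x : UT N => dist x x₀ ≤ 2 * ρ), v x ^ 2 := by
    rw [Finset.mul_sum]
    have e : (univ.filter (fun x : UT N => dist x x₀ ≤ ((2 * ρ : ℕ) : ℝ))) = univ.filter (fun x : UT N => dist x x₀ ≤ 2 * ρ) := by
      congr 1; ext x; push_cast; exact Iff.rfl
    rw [e]
    exact Finset.sum_congr rfl fun x _ => by rw [W_const hc]
  rw [hR'] at hC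
  -- the left side: on bonds with both ends in the inner ball `η = 1`, and the sum over them is part of the full energy
  set E := univ.filter (fun b : UT N × Fin d => dist (bsrc b) x₀ ≤ ρ ∧ dist (btgt b) x₀ ≤ ρ) with hEdef
  have hL : c₀ ^ 2 * ∑ b ∈ E, (v (btgt b) - v (bsrc b)) ^ 2 ≤
      ∑ b : UT N × Fin d, c b ^ 2 * (η (btgt b) * v (btgt b) - η (bsrc b) * v (bsrc b)) ^ 2 := by
    calc c₀ ^ 2 * ∑ b ∈ E, (v (btgt b) - v (bsrc b)) ^ 2
        = ∑ b ∈ E, c b ^ 2 * (η (btgt b) * v (btgt b) - η (bsrc b) * v (bsrc b)) ^ 2 := by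
          rw [Finset.mul_sum]
          refine Finset.sum_congr rfl fun b hb => ?_
          obtain ⟨h1, h2⟩ := (Finset.mem_filter.mp hb).2
          have e1 : η (btgt b) = 1 := by
            rw [hη]; apply cut_eq_one x₀ hρ0; push_cast; linarith
          have e2 : η (bsrc b) = 1 := by
            rw [hη]; apply cut_eq_one x₀ hρ0; push_cast; linarith
          rw [e1, e2, one_mul, one_mul, hc b]
      _ ≤ ∑ b : UT N × Fin d, c b ^ 2 * (η (btgt b) * v (btgt b) - η (bsrc b) * v (bsrc b)) ^ 2 :=
          Finset.sum_le_sum_of_subset_of_nonneg (Finset.subset_univ E) fun b _ _ => by positivity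
  have h1 : c₀ ^ 2 * ∑ b ∈ E, (v (btgt b) - v (bsrc b)) ^ 2 ≤
      c₀ ^ 2 * (26 * d / (ρ : ℝ) ^ 2 * ∑ x ∈ univ.filter (fun x : UT N => dist x x₀ ≤ 2 * ρ), v x ^ 2) := by
    calc _ ≤ 13 / (ρ : ℝ) ^ 2 * (2 * d * c₀ ^ 2 * ∑ x ∈ univ.filter (fun x : UT N => dist x x₀ ≤ 2 * ρ), v x ^ 2) := hL.trans hC
      _ = _ := by ring
  exact le_of_mul_le_mul_left h1 hc2

/-- Pointwise: `(a − b)² ≤ 2(a⁺ − b⁺)² + 2(a⁻ − b⁻)²` with `t⁺ = max t 0`, `t⁻ = max (−t) 0` (`t = t⁺ − t⁻`; and `(t⁺)² + (t⁻)² = t²`, used inline below). [folklore] -/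
theorem sub_sq_le_posPart_negPart (a b : ℝ) :
    (a - b) ^ 2 ≤ 2 * (max a 0 - max b 0) ^ 2 + 2 * (max (-a) 0 - max (-b) 0) ^ 2 := by
  have ha : a = max a 0 - max (-a) 0 := by
    rcases le_total 0 a with h | h
    · rw [max_eq_left h, max_eq_right (by linarith)]; ring
    · rw [max_eq_right h, max_eq_left (by linarith)]; ring
  have hb : b = max b 0 - max (-b) 0 := by
    rcases le_total 0 b with h | h
    · rw [max_eq_left h, max_eq_right (by linarith)]; ring
    · rw [max_eq_right h, max_eq_left (by linarith)]; ring
  have key : (a - b) ^ 2 = ((max a 0 - max b 0) - (max (-a) 0 - max (-b) 0)) ^ 2 := by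
    conv_lhs => rw [ha, hb]
    ring
  rw [key]
  nlinarith [sq_nonneg ((max a 0 - max b 0) + (max (-a) 0 - max (-b) 0))]

/-- **CACCIOPPOLI FOR HARMONIC FUNCTIONS**: constant weight `c ≡ c₀ ≠ 0`, `ρ ≥ 1`, `u` harmonic on `dist(·,x₀) ≤ 2ρ` ⟹
`Σ_{b : both ends in dist ≤ ρ} (u(b₊) − u(b₋))² ≤ (52d∕ρ²)·Σ_{dist ≤ 2ρ} u²` (§3's sub-solution form for `u₊` and `u₋`). [folklore] -/
theorem harmonic_energy_ball_le [NeZero d] {c : UT N × Fin d → ℝ} {c₀ : ℝ} (hc : ∀ b, c b = c₀) (hc₀ : c₀ ≠ 0) (x₀ : UT N)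
    {ρ : ℕ} (hρ : 1 ≤ ρ) (u : UT N → ℝ)
    (hu : ∀ x ∈ univ.filter (fun x : UT N => dist x x₀ ≤ 2 * ρ),
      ((∑ b ∈ univ.filter (fun b : UT N × Fin d => btgt b = x), c b ^ 2) +
          ∑ b ∈ univ.filter (fun b : UT N × Fin d => bsrc b = x), c b ^ 2) * u x =
        ((∑ b ∈ univ.filter (fun b : UT N × Fin d => btgt b = x), c b ^ 2 * u (bsrc b)) +
          ∑ b ∈ univ.filter (fun b : UT N × Fin d => bsrc b = x), c b ^ 2 * u (btgt b))) :
    ∑ b ∈ univ.filter (fun b : UT N × Fin d => dist (bsrc b) x₀ ≤ ρ ∧ dist (btgt b) x₀ ≤ ρ), (u (btgt b) - u (bsrc b)) ^ 2 ≤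
      52 * d / (ρ : ℝ) ^ 2 * ∑ x ∈ univ.filter (fun x : UT N => dist x x₀ ≤ 2 * ρ), u x ^ 2 := by
  set B := univ.filter (fun x : UT N => dist x x₀ ≤ 2 * ρ) with hB
  set E := univ.filter (fun b : UT N × Fin d => dist (bsrc b) x₀ ≤ ρ ∧ dist (btgt b) x₀ ≤ ρ) with hE
  -- `u₊` and `u₋` are nonnegative sub-solutions on the ball
  have hp := posPart_subsolution bsrc btgt c B u (fun x hx => le_of_eq (hu x hx))
  have hn := posPart_subsolution bsrc btgt c B (fun y => -u y) (fun x hx => by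
    have h := hu x hx
    simp only [mul_neg, Finset.sum_neg_distrib]
    linarith)
  have hEp := subsolution_energy_ball_le hc hc₀ x₀ hρ (fun y => max (u y) 0) (fun y => le_max_right _ _) hp
  have hEn := subsolution_energy_ball_le hc hc₀ x₀ hρ (fun y => max (-u y) 0) (fun y => le_max_right _ _) hn
  have hpt : ∀ b : UT N × Fin d, (u (btgt b) - u (bsrc b)) ^ 2 ≤
      2 * (max (u (btgt b)) 0 - max (u (bsrc b)) 0) ^ 2 + 2 * (max (-u (btgt b)) 0 - max (-u (bsrc b)) 0) ^ 2 :=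
    fun b => sub_sq_le_posPart_negPart _ _
  have hsq : ∑ x ∈ B, max (u x) 0 ^ 2 + ∑ x ∈ B, max (-u x) 0 ^ 2 = ∑ x ∈ B, u x ^ 2 := by
    rw [← Finset.sum_add_distrib]
    refine Finset.sum_congr rfl fun x _ => ?_
    rcases le_total 0 (u x) with h | h
    · rw [max_eq_left h, max_eq_right (by linarith)]; ring
    · rw [max_eq_right h, max_eq_left (by linarith)]; ring
  calc ∑ b ∈ E, (u (btgt b) - u (bsrc b)) ^ 2
      ≤ ∑ b ∈ E, (2 * (max (u (btgt b)) 0 - max (u (bsrc b)) 0) ^ 2 + 2 * (max (-u (btgt b)) 0 - max (-u (bsrc b)) 0) ^ 2) :=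
        Finset.sum_le_sum fun b _ => hpt b
    _ = 2 * ∑ b ∈ E, (max (u (btgt b)) 0 - max (u (bsrc b)) 0) ^ 2 + 2 * ∑ b ∈ E, (max (-u (btgt b)) 0 - max (-u (bsrc b)) 0) ^ 2 := by
        rw [Finset.sum_add_distrib, Finset.mul_sum, Finset.mul_sum]
    _ ≤ 2 * (26 * d / (ρ : ℝ) ^ 2 * ∑ x ∈ B, max (u x) 0 ^ 2) + 2 * (26 * d / (ρ : ℝ) ^ 2 * ∑ x ∈ B, max (-u x) 0 ^ 2) := by
        gcongr
    _ = 52 * d / (ρ : ℝ) ^ 2 * (∑ x ∈ B, max (u x) 0 ^ 2 + ∑ x ∈ B, max (-u x) 0 ^ 2) := by ring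
    _ = 52 * d / (ρ : ℝ) ^ 2 * ∑ x ∈ B, u x ^ 2 := by rw [hsq]

/-- **THE ℓ² MASS OF A FORWARD DIFFERENCE ON THE INNER BALL**: `u` harmonic on `dist(·,x₀) ≤ 2R+2` ⟹
`Σ_{dist ≤ R} (u(x + e_μ) − u(x))² ≤ (52d∕(R+1)²)·Σ_{dist ≤ 2R+2} u²` (the `μ`-bonds out of the ball of radius `R` have both ends in the
ball of radius `R + 1`). [folklore] -/
theorem sum_fdiff_sq_ball_le [NeZero d] {c : UT N × Fin d → ℝ} {c₀ : ℝ} (hc : ∀ b, c b = c₀) (hc₀ : c₀ ≠ 0) (x₀ : UT N)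
    (R : ℕ) (u : UT N → ℝ)
    (hu : ∀ x ∈ univ.filter (fun x : UT N => dist x x₀ ≤ 2 * R + 2),
      ((∑ b ∈ univ.filter (fun b : UT N × Fin d => btgt b = x), c b ^ 2) +
          ∑ b ∈ univ.filter (fun b : UT N × Fin d => bsrc b = x), c b ^ 2) * u x =
        ((∑ b ∈ univ.filter (fun b : UT N × Fin d => btgt b = x), c b ^ 2 * u (bsrc b)) +
          ∑ b ∈ univ.filter (fun b : UT N × Fin d => bsrc b = x), c b ^ 2 * u (btgt b)))
    (μ : Fin d) :
    ∑ x ∈ univ.filter (fun x : UT N => dist x x₀ ≤ R), (u (up x μ) - u x) ^ 2 ≤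
      52 * d / ((R : ℝ) + 1) ^ 2 * ∑ x ∈ univ.filter (fun x : UT N => dist x x₀ ≤ 2 * R + 2), u x ^ 2 := by
  classical
  have hρ : 1 ≤ R + 1 := by omega
  have hu' : ∀ x ∈ univ.filter (fun x : UT N => dist x x₀ ≤ 2 * ((R + 1 : ℕ) : ℝ)),
      ((∑ b ∈ univ.filter (fun b : UT N × Fin d => btgt b = x), c b ^ 2) +
          ∑ b ∈ univ.filter (fun b : UT N × Fin d => bsrc b = x), c b ^ 2) * u x =
        ((∑ b ∈ univ.filter (fun b : UT N × Fin d => btgt b = x), c b ^ 2 * u (bsrc b)) +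
          ∑ b ∈ univ.filter (fun b : UT N × Fin d => bsrc b = x), c b ^ 2 * u (btgt b)) := by
    intro x hx
    refine hu x (Finset.mem_filter.mpr ⟨Finset.mem_univ _, ?_⟩)
    have h := (Finset.mem_filter.mp hx).2
    push_cast at h
    linarith
  have hE := harmonic_energy_ball_le hc hc₀ x₀ hρ u hu'
  have ecast : ((R + 1 : ℕ) : ℝ) = (R : ℝ) + 1 := by push_cast; ring
  have eB : univ.filter (fun x : UT N => dist x x₀ ≤ 2 * ((R + 1 : ℕ) : ℝ)) = univ.filter (fun x : UT N => dist x x₀ ≤ 2 * R + 2) := by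
    congr 1; ext x; rw [ecast]; constructor <;> intro h <;> linarith
  rw [eB, ecast] at hE
  refine le_trans ?_ hE
  -- the `μ`-bonds out of the `R`-ball, as a sub-family of the bonds with both ends in the `(R+1)`-ball
  let emb : UT N ↪ UT N × Fin d := ⟨fun x => (x, μ), fun x y h => (Prod.ext_iff.mp h).1⟩
  have hmap : ∑ x ∈ univ.filter (fun x : UT N => dist x x₀ ≤ R), (u (up x μ) - u x) ^ 2 =
      ∑ b ∈ (univ.filter (fun x : UT N => dist x x₀ ≤ R)).map emb, (u (btgt b) - u (bsrc b)) ^ 2 := by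
    rw [Finset.sum_map]
    rfl
  rw [hmap]
  refine Finset.sum_le_sum_of_subset_of_nonneg ?_ fun _ _ _ => sq_nonneg _
  intro b hb
  rw [Finset.mem_map] at hb
  obtain ⟨x, hx, rfl⟩ := hb
  have hxR := (Finset.mem_filter.mp hx).2
  refine Finset.mem_filter.mpr ⟨Finset.mem_univ _, ?_, ?_⟩
  · show dist x x₀ ≤ (R : ℝ) + 1
    linarith
  · show dist (up x μ) x₀ ≤ (R : ℝ) + 1
    linarith [dist_up_le_add_one x x₀ μ]

/-! ## §4 THE INTERIOR DIFFERENCE ESTIMATE -/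

/-- **The gradient constant** `K_d = C_d·√(52d)·3^d` — depends on `d` only. [folklore] -/
def Kgrad (d : ℕ) : ℝ := Cmv d * Real.sqrt (52 * d) * 3 ^ d

/-- **THE INTERIOR DIFFERENCE ESTIMATE FOR LATTICE-HARMONIC FUNCTIONS (free torus Laplacian, constant weight, flat transport).**
`c ≡ c₀ ≠ 0`, `R ≥ 1`, `10R + 4 ≤ N_i`; `u` harmonic (`W·u = Nu`) at every site with `dist(·,x₀) ≤ 2R+2` and `|u| ≤ M` there.  Then for
every axis `μ`: **`|u(x₀ + e_μ) − u(x₀)| ≤ K_d·M∕(R+1)`** — one power of the radius better than the trivial `2M`.  Proof: `v = u(· + e_μ) − u`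
is harmonic on `dist ≤ R` (§2), `|v|` is a nonnegative sub-solution there, DG4 `meanValue_ball` bounds `|v(x₀)|` by `C_d·√(Σ_{dist ≤ R} v²∕R^d)`,
§3 bounds the mass by `52d(R+1)^{−2}·#{dist ≤ 2R+2}·M²`, and `#{dist ≤ 2R+2} ≤ (4R+5)^d ≤ (9R)^d`.
[cite: Balaban1985BackgroundPropagators, Thm 3.1 (3.42) p.397; Balaban1983RegularityDecay, Lemma 2.2 (2.17) p.577] [folklore] -/
theorem harmonic_fdiff_le [NeZero d] {c : UT N × Fin d → ℝ} {c₀ : ℝ} (hc : ∀ b, c b = c₀) (hc₀ : c₀ ≠ 0) (x₀ : UT N) {R : ℕ}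
    (hR : 1 ≤ R) (hN : ∀ i, 10 * R + 4 ≤ N i) (u : UT N → ℝ)
    (hu : ∀ x ∈ univ.filter (fun x : UT N => dist x x₀ ≤ 2 * R + 2),
      ((∑ b ∈ univ.filter (fun b : UT N × Fin d => btgt b = x), c b ^ 2) +
          ∑ b ∈ univ.filter (fun b : UT N × Fin d => bsrc b = x), c b ^ 2) * u x =
        ((∑ b ∈ univ.filter (fun b : UT N × Fin d => btgt b = x), c b ^ 2 * u (bsrc b)) +
          ∑ b ∈ univ.filter (fun b : UT N × Fin d => bsrc b = x), c b ^ 2 * u (btgt b)))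
    {M : ℝ} (hM : ∀ x ∈ univ.filter (fun x : UT N => dist x x₀ ≤ 2 * R + 2), |u x| ≤ M) (μ : Fin d) :
    |u (up x₀ μ) - u x₀| ≤ Kgrad d * M / ((R : ℝ) + 1) := by
  classical
  have hd1 : 1 ≤ d := Nat.one_le_iff_ne_zero.mpr (NeZero.ne d)
  set v : UT N → ℝ := fun y => u (up y μ) - u y with hv
  have hR0 : (0 : ℝ) < R := by exact_mod_cast hR
  have hR1 : (0 : ℝ) < (R : ℝ) + 1 := by linarith
  have hM0 : 0 ≤ M := by
    have h := hM x₀ (Finset.mem_filter.mpr ⟨Finset.mem_univ _, by rw [dist_self]; positivity⟩)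
    exact (abs_nonneg _).trans h
  -- `v` is harmonic on `dist ≤ R` (translation), so `|v|` is a nonnegative sub-solution there: DG4's mean value applies
  have hmv := meanValue_ball hc hc₀ x₀ hR hN (fun y => |v y|) (fun y => abs_nonneg _) (fun x hx => by
    have hxR := (Finset.mem_filter.mp hx).2
    exact abs_subsolution_of_harmonic v x (harmonic_shift_sub hc u μ x
      (hu x (Finset.mem_filter.mpr ⟨Finset.mem_univ _, by linarith⟩))
      (hu (up x μ) (Finset.mem_filter.mpr ⟨Finset.mem_univ _, by linarith [dist_up_le_add_one x x₀ μ]⟩))))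
  -- the ℓ² mass of `v` on the `R`-ball
  have hmass := sum_fdiff_sq_ball_le hc hc₀ x₀ R u hu μ
  -- the mass of `u` on the `(2R+2)`-ball
  have hRN : ∀ i, 2 * R + 2 < N i := fun i => by have := hN i; omega
  have hcard : ((univ.filter fun x : UT N => dist x x₀ ≤ ((2 * R + 2 : ℕ) : ℝ)).card : ℝ) ≤ (2 * (2 * R + 2) + 1 : ℕ) ^ d := by
    exact_mod_cast card_ball_le x₀ hRN
  have ecast : ((2 * R + 2 : ℕ) : ℝ) = 2 * (R : ℝ) + 2 := by push_cast; ring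
  have eB : (univ.filter fun x : UT N => dist x x₀ ≤ ((2 * R + 2 : ℕ) : ℝ)) = univ.filter (fun x : UT N => dist x x₀ ≤ 2 * R + 2) := by
    congr 1; ext x; rw [ecast]
  rw [eB] at hcard
  have hsumu : ∑ x ∈ univ.filter (fun x : UT N => dist x x₀ ≤ 2 * R + 2), u x ^ 2 ≤ (2 * (2 * R + 2) + 1 : ℕ) ^ d * M ^ 2 := by
    calc ∑ x ∈ univ.filter (fun x : UT N => dist x x₀ ≤ 2 * R + 2), u x ^ 2
        ≤ ∑ x ∈ univ.filter (fun x : UT N => dist x x₀ ≤ 2 * R + 2), M ^ 2 := by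
          refine Finset.sum_le_sum fun x hx => ?_
          have h := hM x hx
          rw [← sq_abs]
          exact pow_le_pow_left₀ (abs_nonneg _) h 2
      _ = ((univ.filter fun x : UT N => dist x x₀ ≤ 2 * R + 2).card : ℝ) * M ^ 2 := by
          rw [Finset.sum_const, nsmul_eq_mul]
      _ ≤ (2 * (2 * R + 2) + 1 : ℕ) ^ d * M ^ 2 := mul_le_mul_of_nonneg_right hcard (sq_nonneg _)
  -- `(4R+5)^d ≤ (9R)^d = 9^d·R^d`
  have h9 : ((2 * (2 * R + 2) + 1 : ℕ) : ℝ) ^ d ≤ (9 : ℝ) ^ d * (R : ℝ) ^ d := by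
    rw [← mul_pow]
    refine pow_le_pow_left₀ (by positivity) ?_ d
    have : (1 : ℝ) ≤ R := by exact_mod_cast hR
    push_cast; linarith
  -- assemble: `Σ_{dist ≤ R} v² / R^d ≤ 52d·9^d·M²/(R+1)²`
  have hquot : (∑ x ∈ univ.filter (fun x : UT N => dist x x₀ ≤ R), |v x| ^ 2) / (R : ℝ) ^ d ≤
      52 * d * 9 ^ d * M ^ 2 / ((R : ℝ) + 1) ^ 2 := by
    have hRd : (0 : ℝ) < (R : ℝ) ^ d := pow_pos hR0 d
    rw [div_le_iff₀ hRd]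
    have e1 : ∑ x ∈ univ.filter (fun x : UT N => dist x x₀ ≤ R), |v x| ^ 2 =
        ∑ x ∈ univ.filter (fun x : UT N => dist x x₀ ≤ R), (u (up x μ) - u x) ^ 2 :=
      Finset.sum_congr rfl fun x _ => by rw [sq_abs]
    rw [e1]
    calc ∑ x ∈ univ.filter (fun x : UT N => dist x x₀ ≤ R), (u (up x μ) - u x) ^ 2
        ≤ 52 * d / ((R : ℝ) + 1) ^ 2 * ∑ x ∈ univ.filter (fun x : UT N => dist x x₀ ≤ 2 * R + 2), u x ^ 2 := hmass
      _ ≤ 52 * d / ((R : ℝ) + 1) ^ 2 * ((2 * (2 * R + 2) + 1 : ℕ) ^ d * M ^ 2) :=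
          mul_le_mul_of_nonneg_left hsumu (by positivity)
      _ ≤ 52 * d / ((R : ℝ) + 1) ^ 2 * ((9 : ℝ) ^ d * (R : ℝ) ^ d * M ^ 2) :=
          mul_le_mul_of_nonneg_left (mul_le_mul_of_nonneg_right h9 (sq_nonneg _)) (by positivity)
      _ = 52 * d * 9 ^ d * M ^ 2 / ((R : ℝ) + 1) ^ 2 * (R : ℝ) ^ d := by
          field_simp
  -- take square roots
  have hsqrt : Real.sqrt ((∑ x ∈ univ.filter (fun x : UT N => dist x x₀ ≤ R), |v x| ^ 2) / (R : ℝ) ^ d) ≤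
      Real.sqrt (52 * d) * 3 ^ d * M / ((R : ℝ) + 1) := by
    refine (Real.sqrt_le_sqrt hquot).trans (le_of_eq ?_)
    have e : 52 * (d : ℝ) * 9 ^ d * M ^ 2 / ((R : ℝ) + 1) ^ 2 = (Real.sqrt (52 * d) * 3 ^ d * M / ((R : ℝ) + 1)) ^ 2 := by
      rw [div_pow, mul_pow, mul_pow, Real.sq_sqrt (by positivity), ← pow_mul, show (3 : ℝ) ^ (d * 2) = 9 ^ d by
        rw [mul_comm, pow_mul]; norm_num]
    rw [e, Real.sqrt_sq (by positivity)]
  have hfin := hmv.trans (mul_le_mul_of_nonneg_left hsqrt (Cmv_pos hd1).le)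
  have e2 : Cmv d * (Real.sqrt (52 * d) * 3 ^ d * M / ((R : ℝ) + 1)) = Kgrad d * M / ((R : ℝ) + 1) := by
    unfold Kgrad; ring
  rw [e2] at hfin
  exact hfin

end

end Summit.QuantumFields.BalabanUV.Beta.HarmonicGradientInterior
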